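import Literature.NumberTheory.Sieve.RankinSmoothNumbers
import Literature.NumberTheory.Sieve.PsiPolylogLowerBound
import Mathlib.Analysis.SpecialFunctions.Integrals.Basic
import Mathlib.Analysis.SumIntegralComparisons
import HarnessLib

/-!
# Rankin's upper bound `ψ(x, logᵏ x) ≤ x^{1 - 1/κ + ε}`, hence `ψ(x, logᵏ x) = x^{1 - 1/κ + o(1)}`

Topic `NumberTheory/Sieve` (smooth numbers); companion of `PsiPolylogLowerBound.lean` (de Bruijn's
lower bound `ψ(x, logᵏ x) ≥ x^{1 - 1/κ - ε}`), same vocabulary: `ψ(x, y) = #(factoredUpTo (Nat.primesLE y) x)`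
`= #(Nat.smoothNumbersUpTo x (y + 1))`. Everything here is PROVED:

* `prod_primesBelow_inv_one_sub_rpow_le_exp` — for `0 < σ < 1`,
  `∏_{p < k} (1 - p^{-σ})⁻¹ ≤ exp((1 + k^{1-σ}/(1-σ)) / (1 - 2^{-σ}))`
  (`-log(1 - v) ≤ v/(1 - v)` and `∑_{p<k} p^{-σ} ≤ ∑_{2 ≤ n ≤ k} n^{-σ} ≤ ∫₁ᵏ t^{-σ} dt`);
* `card_smoothNumbersUpTo_polylog_le` / `card_factoredUpTo_polylog_le` — for `κ > 1`, `ε > 0` and all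
  large `x : ℕ`, `ψ(x, ⌊(log x)^κ⌋) ≤ x^{1 - 1/κ + ε}`: Rankin's method (the tree's
  `card_smoothNumbersUpTo_le_rankin`, `ψ(N, k) ≤ N^σ ∏_{p<k}(1 - p^{-σ})⁻¹`) with `σ = 1 - 1/κ + ε/2`,
  where `k^{1-σ} ≤ 2 (log x)^{1 - κε/2} = o(log x)` makes the Euler product `x^{o(1)}`;
* `card_factoredUpTo_polylog_sandwich` — both halves: `x^{1-1/κ-ε} ≤ ψ(x, ⌊logᵏ x⌋) ≤ x^{1-1/κ+ε}`
  eventually, i.e. `ψ(x, logᵏ x) = x^{1 - 1/κ + o(1)}`, the estimate quoted in [Harper2016, §2.1,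
  footnote 3; §1] from Hildebrand–Tenenbaum ("which can actually be proved more simply").

NOT here: saddle-point asymptotics (Hildebrand–Tenenbaum), de Bruijn's `Ψ(x,y) ≤ x e^{-(1+o(1)) u log u}`.

## References

* [Harper2016] A. J. Harper, Compositio Math. 152 (2016) 1121–1158, §2.1 footnote 3 (arXiv:1408.1662).
* [MontgomeryVaughan2007] H. L. Montgomery, R. C. Vaughan, *Multiplicative Number Theory I*, §7.1
  (7.17) (Rankin's method).
-/

noncomputable section

open Real Filter Finset

namespace Literature.NumberTheory.Sieve

/-! ### The Euler product for `0 < σ < 1` -/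

/-- `∑_{p < k} p^{-σ} ≤ 1 + k^{1-σ}/(1-σ)` for `0 < σ < 1` (compare with `∫₁ᵏ t^{-σ} dt`). [folklore] -/
theorem sum_primesBelow_rpow_neg_le_of_lt_one {σ : ℝ} (hσ0 : 0 < σ) (hσ1 : σ < 1) (k : ℕ) :
    ∑ p ∈ k.primesBelow, (p : ℝ) ^ (-σ) ≤ 1 + (k : ℝ) ^ (1 - σ) / (1 - σ) := by
  have h1σ : 0 < 1 - σ := by linarith
  rcases Nat.eq_zero_or_pos k with rfl | hk
  · simp only [Nat.primesBelow, Finset.range_zero, Finset.filter_empty, Finset.sum_empty]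
    positivity
  -- `∑_{p<k} p^{-σ} ≤ ∑_{i ∈ [1,k)} (i+1)^{-σ}` (shift `p ↦ p - 1`)
  have hinj : ∀ p ∈ k.primesBelow, ∀ q ∈ k.primesBelow, p - 1 = q - 1 → p = q := by
    intro p hp q hq h
    have := (Nat.prime_of_mem_primesBelow hp).one_le
    have := (Nat.prime_of_mem_primesBelow hq).one_le
    omega
  have hsub : (k.primesBelow).image (fun p => p - 1) ⊆ Finset.Ico 1 k := by
    intro i hi
    obtain ⟨p, hp, rfl⟩ := Finset.mem_image.1 hi
    have h2 := (Nat.prime_of_mem_primesBelow hp).two_le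
    have hk' := Nat.lt_of_mem_primesBelow hp
    simp only [Finset.mem_Ico]
    omega
  have hstep : ∑ p ∈ k.primesBelow, (p : ℝ) ^ (-σ) ≤
      ∑ i ∈ Finset.Ico 1 k, ((i + 1 : ℕ) : ℝ) ^ (-σ) := by
    calc ∑ p ∈ k.primesBelow, (p : ℝ) ^ (-σ)
        = ∑ p ∈ k.primesBelow, ((p - 1 + 1 : ℕ) : ℝ) ^ (-σ) := by
          refine Finset.sum_congr rfl fun p hp => ?_
          rw [Nat.sub_add_cancel (Nat.prime_of_mem_primesBelow hp).one_le]
      _ = ∑ i ∈ (k.primesBelow).image (fun p => p - 1), ((i + 1 : ℕ) : ℝ) ^ (-σ) :=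
          (Finset.sum_image (f := fun i : ℕ => ((i + 1 : ℕ) : ℝ) ^ (-σ)) hinj).symm
      _ ≤ ∑ i ∈ Finset.Ico 1 k, ((i + 1 : ℕ) : ℝ) ^ (-σ) :=
          Finset.sum_le_sum_of_subset_of_nonneg hsub fun i _ _ =>
            Real.rpow_nonneg (Nat.cast_nonneg _) _
  -- `∑_{i ∈ [1,k)} (i+1)^{-σ} ≤ ∫₁ᵏ t^{-σ} dt = (k^{1-σ} - 1)/(1-σ)`
  have hanti : AntitoneOn (fun t : ℝ => t ^ (-σ)) (Set.Icc (1 : ℕ) (k : ℕ)) := by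
    intro s hs t _ hst
    have hs1 : (0 : ℝ) < s := by
      have : ((1 : ℕ) : ℝ) ≤ s := hs.1
      push_cast at this; linarith
    exact Real.rpow_le_rpow_of_nonpos hs1 hst (by linarith)
  have hint := AntitoneOn.sum_le_integral_Ico hk hanti
  have hval : ∫ t in ((1 : ℕ) : ℝ)..((k : ℕ) : ℝ), t ^ (-σ) = ((k : ℝ) ^ (1 - σ) - 1) / (1 - σ) := by
    rw [integral_rpow (Or.inl (by linarith))]
    push_cast
    rw [Real.one_rpow, show -σ + 1 = 1 - σ by ring]
  rw [hval] at hint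
  have hk0 : (0 : ℝ) ≤ (k : ℝ) ^ (1 - σ) := by positivity
  calc ∑ p ∈ k.primesBelow, (p : ℝ) ^ (-σ) ≤ ((k : ℝ) ^ (1 - σ) - 1) / (1 - σ) := hstep.trans hint
    _ ≤ (k : ℝ) ^ (1 - σ) / (1 - σ) := div_le_div_of_nonneg_right (by linarith) h1σ.le
    _ ≤ 1 + (k : ℝ) ^ (1 - σ) / (1 - σ) := by linarith

/-- **Euler product bound for `0 < σ < 1`**:
`∏_{p < k} (1 - p^{-σ})⁻¹ ≤ exp((1 + k^{1-σ}/(1-σ)) / (1 - 2^{-σ}))`, from `(1 - v)⁻¹ ≤ exp(v/(1 - v))`,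
`v = p^{-σ} ≤ 2^{-σ}`, and `sum_primesBelow_rpow_neg_le_of_lt_one`. [folklore] -/
theorem prod_primesBelow_inv_one_sub_rpow_le_exp {σ : ℝ} (hσ0 : 0 < σ) (hσ1 : σ < 1) (k : ℕ) :
    ∏ p ∈ k.primesBelow, (1 - (p : ℝ) ^ (-σ))⁻¹ ≤
      Real.exp ((1 + (k : ℝ) ^ (1 - σ) / (1 - σ)) / (1 - (2 : ℝ) ^ (-σ))) := by
  set v₀ : ℝ := (2 : ℝ) ^ (-σ) with hv₀
  have hv₀1 : v₀ < 1 := Real.rpow_lt_one_of_one_lt_of_neg one_lt_two (by linarith)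
  have h1v₀ : 0 < 1 - v₀ := by linarith
  have hfac : ∀ p ∈ k.primesBelow,
      (1 - (p : ℝ) ^ (-σ))⁻¹ ≤ Real.exp ((p : ℝ) ^ (-σ) / (1 - v₀)) := by
    intro p hp
    have hp2 : (2 : ℝ) ≤ p := by exact_mod_cast (Nat.prime_of_mem_primesBelow hp).two_le
    have hv : (p : ℝ) ^ (-σ) ≤ v₀ := Real.rpow_le_rpow_of_nonpos two_pos hp2 (by linarith)
    have hvp0 : 0 < (p : ℝ) ^ (-σ) := Real.rpow_pos_of_pos (by linarith) _
    have h1v : 0 < 1 - (p : ℝ) ^ (-σ) := by linarith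
    rw [← Real.exp_log (inv_pos.2 h1v)]
    refine Real.exp_le_exp.2 ((Real.log_le_sub_one_of_pos (inv_pos.2 h1v)).trans ?_)
    have heq : (1 - (p : ℝ) ^ (-σ))⁻¹ - 1 = (p : ℝ) ^ (-σ) / (1 - (p : ℝ) ^ (-σ)) := by
      field_simp
      ring
    rw [heq]
    exact div_le_div_of_nonneg_left hvp0.le h1v₀ (by linarith)
  have hnonneg : ∀ p ∈ k.primesBelow, 0 ≤ (1 - (p : ℝ) ^ (-σ))⁻¹ := by
    intro p hp
    have hp2 : (2 : ℝ) ≤ p := by exact_mod_cast (Nat.prime_of_mem_primesBelow hp).two_le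
    have hv : (p : ℝ) ^ (-σ) ≤ v₀ := Real.rpow_le_rpow_of_nonpos two_pos hp2 (by linarith)
    exact inv_nonneg.2 (by linarith)
  calc ∏ p ∈ k.primesBelow, (1 - (p : ℝ) ^ (-σ))⁻¹
      ≤ ∏ p ∈ k.primesBelow, Real.exp ((p : ℝ) ^ (-σ) / (1 - v₀)) := Finset.prod_le_prod hnonneg hfac
    _ = Real.exp (∑ p ∈ k.primesBelow, (p : ℝ) ^ (-σ) / (1 - v₀)) := (Real.exp_sum _ _).symm
    _ ≤ Real.exp ((1 + (k : ℝ) ^ (1 - σ) / (1 - σ)) / (1 - v₀)) := by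
        rw [Real.exp_le_exp, ← Finset.sum_div]
        exact div_le_div_of_nonneg_right (sum_primesBelow_rpow_neg_le_of_lt_one hσ0 hσ1 k) h1v₀.le

/-! ### The upper bound `ψ(x, logᵏ x) ≤ x^{1 - 1/κ + ε}` -/

/-- **Rankin's upper bound in the polylogarithmic range**: for `κ > 1`, `ε > 0` and all large
`x : ℕ`, `#(Nat.smoothNumbersUpTo x (⌊(log x)^κ⌋ + 1)) ≤ x^{1 - 1/κ + ε}` — at most `x^{1 - 1/κ + ε}`
integers `1 ≤ n ≤ x` have all prime factors `≤ (log x)^κ` (the upper half of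
`ψ(x, logᵏ x) = x^{1 - 1/κ + o(1)}`). Rankin's method with `σ = 1 - 1/κ + ε/2` (module docstring).
[cite: Harper2016, §2.1 (footnote: Ψ(x, log^K x) = x^{1-1/K+o(1)})] -/
theorem card_smoothNumbersUpTo_polylog_le {κ ε : ℝ} (hκ : 1 < κ) (hε : 0 < ε) :
    ∀ᶠ x : ℕ in atTop,
      ((Nat.smoothNumbersUpTo x (⌊Real.log x ^ κ⌋₊ + 1)).card : ℝ) ≤ (x : ℝ) ^ (1 - 1 / κ + ε) := by
  have hκ0 : 0 < κ := one_pos.trans hκ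
  have hκinv : 1 / κ < 1 := by rw [div_lt_one hκ0]; exact hκ
  have hκinv0 : 0 < 1 / κ := by positivity
  -- shrink `ε` so that `σ = 1 - 1/κ + ε'/2 < 1`
  set ε' : ℝ := min ε (1 / κ) with hε'
  have hε'0 : 0 < ε' := lt_min hε hκinv0
  have hε'ε : ε' ≤ ε := min_le_left _ _
  have hε'κ : ε' ≤ 1 / κ := min_le_right _ _
  set σ : ℝ := 1 - 1 / κ + ε' / 2 with hσ
  have hσ0 : 0 < σ := by rw [hσ]; linarith
  have hσ1 : σ < 1 := by rw [hσ]; linarith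
  have h1σ : 0 < 1 - σ := by linarith
  set A : ℝ := (1 - (2 : ℝ) ^ (-σ))⁻¹ with hA
  have hv₀1 : (2 : ℝ) ^ (-σ) < 1 := Real.rpow_lt_one_of_one_lt_of_neg one_lt_two (by linarith)
  have hA0 : 0 < A := inv_pos.2 (by linarith)
  set B : ℝ := 1 / (1 - σ) with hB
  have hB0 : 0 < B := by positivity
  -- `θ = κ (1 - σ) = 1 - κ ε'/2 < 1`
  set θ : ℝ := κ * (1 - σ) with hθ
  have hθ1 : 0 < 1 - θ := by
    have : θ = 1 - κ * ε' / 2 := by rw [hθ, hσ]; field_simp; ring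
    rw [this]; nlinarith
  -- eventual conditions
  have hcast : Tendsto (fun x : ℕ => (x : ℝ)) atTop atTop := tendsto_natCast_atTop_atTop
  have Tℓ : Tendsto (fun x : ℕ => Real.log x) atTop atTop := Real.tendsto_log_atTop.comp hcast
  have E0 : ∀ᶠ x : ℕ in atTop, (1 : ℝ) ≤ x := hcast.eventually_ge_atTop 1
  have E1 : ∀ᶠ x : ℕ in atTop, (1 : ℝ) ≤ Real.log x := Tℓ.eventually_ge_atTop 1
  have E2 : ∀ᶠ x : ℕ in atTop, A ≤ ε' / 4 * Real.log x := by
    have := (Tℓ.const_mul_atTop (by positivity : 0 < ε' / 4)).eventually_ge_atTop A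
    exact this
  have E3 : ∀ᶠ x : ℕ in atTop, Real.log x ^ (-(1 - θ)) ≤ ε' / (8 * A * B) := by
    have h := (tendsto_rpow_neg_atTop hθ1).comp Tℓ
    exact h.eventually (ge_mem_nhds (by positivity))
  filter_upwards [E0, E1, E2, E3] with x h0 h1 h2 h3
  set ℓ : ℝ := Real.log x with hℓ
  have hx0 : (0 : ℝ) < x := one_pos.trans_le h0
  have hℓ0 : 0 < ℓ := one_pos.trans_le h1
  set k : ℕ := ⌊ℓ ^ κ⌋₊ + 1 with hk
  have hy1 : 1 ≤ ℓ ^ κ := Real.one_le_rpow h1 hκ0.le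
  have hy0 : 0 ≤ ℓ ^ κ := zero_le_one.trans hy1
  -- Rankin: `ψ ≤ x^σ ∏ ≤ x^σ exp(A (1 + B k^{1-σ}))`
  have hR := card_smoothNumbersUpTo_le_rankin x k hσ0
  have hP := prod_primesBelow_inv_one_sub_rpow_le_exp hσ0 hσ1 k
  -- `k^{1-σ} ≤ 2 ℓ^θ`
  have hk2 : (k : ℝ) ≤ 2 * ℓ ^ κ := by
    have : (k : ℝ) = ⌊ℓ ^ κ⌋₊ + 1 := by rw [hk]; push_cast; ring
    rw [this]
    linarith [Nat.floor_le hy0]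
  have hkpow : (k : ℝ) ^ (1 - σ) ≤ 2 * ℓ ^ θ := by
    calc (k : ℝ) ^ (1 - σ) ≤ (2 * ℓ ^ κ) ^ (1 - σ) :=
          Real.rpow_le_rpow (Nat.cast_nonneg _) hk2 h1σ.le
      _ = (2 : ℝ) ^ (1 - σ) * ℓ ^ θ := by
          rw [Real.mul_rpow zero_le_two hy0, ← Real.rpow_mul hℓ0.le, hθ]
      _ ≤ 2 * ℓ ^ θ := by
          refine mul_le_mul_of_nonneg_right ?_ (by positivity)
          calc (2 : ℝ) ^ (1 - σ) ≤ (2 : ℝ) ^ (1 : ℝ) :=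
                Real.rpow_le_rpow_of_exponent_le one_le_two (by linarith)
            _ = 2 := Real.rpow_one 2
  -- `A (1 + B k^{1-σ}) ≤ ε'/2 · ℓ`
  have hℓθ : ℓ ^ θ = ℓ * ℓ ^ (-(1 - θ)) := by
    conv_lhs => rw [show θ = 1 + -(1 - θ) by ring]
    rw [Real.rpow_add hℓ0, Real.rpow_one]
  have hexpo : (1 + (k : ℝ) ^ (1 - σ) / (1 - σ)) / (1 - (2 : ℝ) ^ (-σ)) ≤ ε' / 2 * ℓ := by
    have hrew : (1 + (k : ℝ) ^ (1 - σ) / (1 - σ)) / (1 - (2 : ℝ) ^ (-σ)) =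
        A * (1 + B * (k : ℝ) ^ (1 - σ)) := by
      rw [hA, hB, div_eq_mul_inv, mul_comm]; ring
    rw [hrew]
    have h4 : A * (B * (k : ℝ) ^ (1 - σ)) ≤ ε' / 4 * ℓ := by
      calc A * (B * (k : ℝ) ^ (1 - σ)) ≤ A * (B * (2 * ℓ ^ θ)) := by gcongr
        _ = 2 * A * B * ℓ * ℓ ^ (-(1 - θ)) := by rw [hℓθ]; ring
        _ ≤ 2 * A * B * ℓ * (ε' / (8 * A * B)) :=
            mul_le_mul_of_nonneg_left h3 (by positivity)
        _ = ε' / 4 * ℓ := by field_simp; ring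
    calc A * (1 + B * (k : ℝ) ^ (1 - σ)) = A + A * (B * (k : ℝ) ^ (1 - σ)) := by ring
      _ ≤ ε' / 4 * ℓ + ε' / 4 * ℓ := add_le_add h2 h4
      _ = ε' / 2 * ℓ := by ring
  -- assemble
  have hprod0 : 0 ≤ ∏ p ∈ k.primesBelow, (1 - (p : ℝ) ^ (-σ))⁻¹ := by
    refine Finset.prod_nonneg fun p hp => inv_nonneg.2 ?_
    have hp2 : (2 : ℝ) ≤ p := by exact_mod_cast (Nat.prime_of_mem_primesBelow hp).two_le
    have hv : (p : ℝ) ^ (-σ) ≤ (2 : ℝ) ^ (-σ) := Real.rpow_le_rpow_of_nonpos two_pos hp2 (by linarith)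
    linarith
  calc ((Nat.smoothNumbersUpTo x k).card : ℝ)
      ≤ (x : ℝ) ^ σ * ∏ p ∈ k.primesBelow, (1 - (p : ℝ) ^ (-σ))⁻¹ := hR
    _ ≤ (x : ℝ) ^ σ * Real.exp (ε' / 2 * ℓ) :=
        mul_le_mul_of_nonneg_left (hP.trans (Real.exp_le_exp.2 hexpo)) (by positivity)
    _ = (x : ℝ) ^ (σ + ε' / 2) := by
        rw [Real.rpow_add hx0 σ (ε' / 2)]
        congr 1
        rw [Real.rpow_def_of_pos hx0, hℓ, mul_comm]
    _ ≤ (x : ℝ) ^ (1 - 1 / κ + ε) := by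
        refine Real.rpow_le_rpow_of_exponent_le h0 ?_
        rw [hσ]; linarith

/-- `card_smoothNumbersUpTo_polylog_le` in the `factoredUpTo` vocabulary: for `κ > 1`, `ε > 0` and
all large `x`, `ψ(x, ⌊(log x)^κ⌋) = #(factoredUpTo (Nat.primesLE ⌊(log x)^κ⌋) x) ≤ x^{1 - 1/κ + ε}`.
[cite: Harper2016, §2.1 (footnote: Ψ(x, log^K x) = x^{1-1/K+o(1)})] -/
theorem card_factoredUpTo_polylog_le {κ ε : ℝ} (hκ : 1 < κ) (hε : 0 < ε) :
    ∀ᶠ x : ℕ in atTop,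
      (#(factoredUpTo (Nat.primesLE ⌊Real.log x ^ κ⌋₊) x) : ℝ) ≤ (x : ℝ) ^ (1 - 1 / κ + ε) := by
  filter_upwards [card_smoothNumbersUpTo_polylog_le hκ hε] with x hx
  rwa [factoredUpTo_primesLE_eq_smoothNumbersUpTo]

/-- **`ψ(x, logᵏ x) = x^{1 - 1/κ + o(1)}`** (both halves): for `κ > 1` and `ε > 0`, for all large
`x : ℕ`, `x^{1 - 1/κ - ε} ≤ ψ(x, ⌊(log x)^κ⌋) ≤ x^{1 - 1/κ + ε}` — de Bruijn's lower bound
(`card_factoredUpTo_polylog_ge`) and Rankin's upper bound (`card_factoredUpTo_polylog_le`).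
[cite: Harper2016, §2.1 (footnote: Ψ(x, log^K x) = x^{1-1/K+o(1)})] -/
theorem card_factoredUpTo_polylog_sandwich {κ ε : ℝ} (hκ : 1 < κ) (hε : 0 < ε) :
    ∀ᶠ x : ℕ in atTop,
      (x : ℝ) ^ (1 - 1 / κ - ε) ≤ #(factoredUpTo (Nat.primesLE ⌊Real.log x ^ κ⌋₊) x) ∧
        (#(factoredUpTo (Nat.primesLE ⌊Real.log x ^ κ⌋₊) x) : ℝ) ≤ (x : ℝ) ^ (1 - 1 / κ + ε) :=
  (card_factoredUpTo_polylog_ge hκ hε).and (card_factoredUpTo_polylog_le hκ hε)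

end Literature.NumberTheory.Sieve

end
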